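import Literature.IUT.LogVolume.Corollary22RatPointDictionary
import Literature.IUT.LogVolume.Corollary22FreyPoint
import Summits.ABC.IUTFork.Conditional.AbcOfSHwindowFreyRefutationAdmissible
import Summits.ABC.ABC.Theorems.IUTThetaPilotThetaPartIIStubThetaData
import HarnessLib

/-!
# ADMISSIBILITY AS TYPED and INHABITED DATUM TYPES at the Frey–Legendre point of an abc triple, LIST FORM:
# `UP`, (P2), (P5), `AdmitsCore` from the factorisation of `abc`, and `∀ l ∈ L, Nonempty (ThetaVolumeDatumAt (ratPoint (a/c)) l)` given (P6)

PROOF-ONLY file (D-0012; 0 definitions, 0 `Prop` facts, no instance, no notation) of the abc-iut cell (seat abc-iut-w6-d102, gen 5;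
row «C:P6-KERNEL-N3», part 2). Part 1 (p484675 + 31 data files) made (P6) = `Cor22.CondP6 (ratPoint λ) l` a kernel theorem at every
tabulated `(triple, l)` of the R-W WINDOW-TABLE. The «refuted by unconditional theorem» rows there quantify over
`T : Cor22.ThetaVolumeDatumAt (ratPoint λ) l`; their NON-VACUITY is `Nonempty (ThetaVolumeDatumAt (ratPoint λ) l)`, which the route's
`ThetaPartII.stub_thetaData` (Summits.ABC.ABC.Theorems, [IUTchIV] Cor. 2.2 (ii) proof (P7)) yields from `P ∈ UP`, `l ≥ 5` prime,
`AdmitsCore`, (P2), (P5), (P6). This file makes the four elementary inputs DECIDABLE DATA of the triple: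

for an abc triple `a + b = c` (`IsABCTriple a b c`) with `(abc)² = ∏_{p ∈ Il} p^{e_p}` (a list `Il` of primes, `e_p ≥ 1`) —
`j(a/c) = 2⁸(cb + a²)³/(abc)²` (`Cor22.jInv_ratPoint_triple`, abc-iut-S6), `cb + a²` ODD and coprime to the odd part of `abc`:
* `ord_jInv_of_mem_odd`: at the place over an odd `p ∈ Il`, `ord_v j(a/c) = −e_p`; `ord_jInv_two`: over `2`, `ord_v j = 8 − e_2`
  (`e_2 := 0` if `2 ∉ Il`); `ord_jInv_nonneg_of_not_mem`: `ord_v j ≥ 0` elsewhere;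
* **(P2)** `condP2_triple` ⟸ `∀ p ∈ Il, p ≠ 2 → l ∤ e_p` and `2 ∈ Il → 8 < e_2 → l ∤ e_2 − 8`;
* **(P5)** `condP5_triple` ⟸ some `p₀ ∈ Il`, `p₀ ≠ 2`, `p₀ ≠ l`;
* **`AdmitsCore`** `admitsCore_triple` ⟸ `2⁸(cb+a²)³/(abc)² ∉ {488095744/125, 1556068/81, 1728, 0}` (a `decide +kernel` on `ℚ` literals);
* `UP` is W-ref-3's `FreyRef.ratPoint_triple_mem_UP`;
* **`nonempty_thetaVolumeDatumAt_triple_list`**: all of the above + `∀ l ∈ L, CondP6 (ratPoint (a/c)) l` ⇒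
  `∀ l ∈ L, Nonempty (Cor22.ThetaVolumeDatumAt (ratPoint (a/c)) l)`, the per-`l` side conditions being ONE `decide +kernel` over `L`.

HONEST SCOPE: classical arithmetic of `ℚ` (orders of `j(a/c)` at the primes of `abc`) plus ONE application of the route's proved
`stub_thetaData`; «inhabited datum type» says our TYPED `ThetaVolumeDatumAt` has an element at `(ratPoint (a/c), l)` — nothing about
[IUTchIII] Cor. 3.12 or the truth of any S_H; refuted-as-typed ≠ refuted-in-print; no side taken on any author; typed ≠ proved; no abc claim.
[cite: Mochizuki2012, IUTchIV Cor. 2.2 (ii) proof (P2)(P5)(P7) p. 45–46, p. 43 (core)] [cite: MochizukiGenEll2010, Def. 3.3 p. 12, Ex. 1.3 (i) p. 5]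
[cite: SilvermanAEC2009, Prop. III.1.7(b)] [claim: Mochizuki2012, status: disputed] for every IUT sentence quoted.
-/

noncomputable section

open scoped Classical

namespace Summit.ABC.IUTFork.Conditional

namespace FreyAdm

open NumberField IsDedekindDomain Literature.IUT.LogVolume Literature.IUT.LogVolume.Cor22
open Literature.NumberTheory.DiophantineGeometry Literature.NumberTheory.DiophantineGeometry.GenEll
open Literature.NumberTheory.DiophantineGeometry.UniformABCConjecture Rat.HeightOneSpectrum
open Summit.ABC.ABC.Theorems

variable {a b c : ℕ}

/-! ## §1 The numerator `2⁸(cb + a²)³` of `j(a/c)` -/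

/-- For an abc triple, `cb + a²` is odd (`a`, `b` are not both even). [folklore] -/
theorem two_not_dvd_K (h : IsABCTriple a b c) : ¬ 2 ∣ (c * b + a * a) := by
  obtain ⟨ha, hb, habc, hcop⟩ := h
  subst habc
  intro h2
  have hmod : (((a + b) * b + a * a) % 2) = 0 := Nat.mod_eq_zero_of_dvd h2
  have ha2 := Nat.mod_two_eq_zero_or_one a
  have hb2 := Nat.mod_two_eq_zero_or_one b
  have key : ((a + b) * b + a * a) % 2 = ((a % 2 + b % 2) * (b % 2) + (a % 2) * (a % 2)) % 2 := by
    simp [Nat.add_mod, Nat.mul_mod]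
  rcases ha2 with ha2 | ha2 <;> rcases hb2 with hb2 | hb2
  · -- both even: contradicts coprimality
    have h2a : 2 ∣ a := Nat.dvd_of_mod_eq_zero ha2
    have h2b : 2 ∣ b := Nat.dvd_of_mod_eq_zero hb2
    exact absurd (Nat.eq_one_of_dvd_coprimes hcop h2a h2b) (by norm_num)
  · rw [key, ha2, hb2] at hmod; norm_num at hmod
  · rw [key, ha2, hb2] at hmod; norm_num at hmod
  · rw [key, ha2, hb2] at hmod; norm_num at hmod

/-- The numerator `2⁸(cb + a²)³` is nonzero. [folklore] -/
theorem numerator_ne_zero (h : IsABCTriple a b c) : 256 * (c * b + a * a) ^ 3 ≠ 0 := by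
  have ha : 0 < a := h.1
  positivity

/-- `v₂(2⁸(cb + a²)³) = 8`. [folklore] -/
theorem factorization_numerator_two (h : IsABCTriple a b c) : (256 * (c * b + a * a) ^ 3).factorization 2 = 8 := by
  have hK : (c * b + a * a) ≠ 0 := fun h0 => two_not_dvd_K h (h0 ▸ dvd_zero 2)
  rw [Nat.factorization_mul (by norm_num) (pow_ne_zero _ hK), Finsupp.add_apply, Nat.factorization_pow, Finsupp.smul_apply,
    Nat.factorization_eq_zero_of_not_dvd (two_not_dvd_K h), smul_zero, add_zero,
    show (256 : ℕ) = 2 ^ 8 by norm_num, Nat.Prime.factorization_pow Nat.prime_two, Finsupp.single_eq_same]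

/-! ## §2 The pole dictionary from a factorisation list of `(abc)²` -/

section Dict

variable {Il : List ℕ} {e : ℕ → ℕ}

/-- The factorisation of `∏_{p ∈ Il} p^{e_p}` at a prime `p₀`. [folklore] -/
theorem factorization_list_prod (hI : ∀ p ∈ Il, p.Prime) (hnd : Il.Nodup) (p₀ : ℕ) :
    ((Il.map fun p => p ^ e p).prod).factorization p₀ = if p₀ ∈ Il then e p₀ else 0 := by
  rw [← List.prod_toFinset _ hnd, Nat.factorization_prod_apply fun p hp => pow_ne_zero _ (hI p (List.mem_toFinset.mp hp)).ne_zero,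
    Finset.sum_congr rfl fun p hp => by
      rw [Nat.Prime.factorization_pow (hI p (List.mem_toFinset.mp hp)), Finsupp.single_apply]]
  rw [Finset.sum_ite_eq' Il.toFinset p₀ e]
  simp only [List.mem_toFinset]

/-- With `(abc)² = ∏_{p ∈ Il} p^{e_p}`: `e_p = 2·v_p(abc)` for `p ∈ Il`. [folklore] -/
theorem e_eq_two_mul_factorization (hI : ∀ p ∈ Il, p.Prime) (hnd : Il.Nodup)
    (hD : (a * b * c) ^ 2 = (Il.map fun p => p ^ e p).prod) {p : ℕ} (hp : p ∈ Il) :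
    e p = 2 * (a * b * c).factorization p := by
  have h1 := factorization_list_prod (e := e) hI hnd p
  rw [← hD, Nat.factorization_pow, Finsupp.smul_apply, smul_eq_mul, if_pos hp] at h1
  exact h1.symm

/-- The Finset form of the factorisation hypothesis. [folklore] -/
theorem prod_toFinset_eq (hnd : Il.Nodup) (hD : (a * b * c) ^ 2 = (Il.map fun p => p ^ e p).prod) :
    (a * b * c) ^ 2 = ∏ p ∈ Il.toFinset, p ^ e p := by
  rw [List.prod_toFinset _ hnd]; exact hD

/-- **`ord_v j(a/c)` in terms of the list dictionary**: `= v_p(2⁸(cb+a²)³) − e_p·[p ∈ Il]`, `p` the prime under `v`.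
[cite: MochizukiGenEll2010, Def. 3.3 p. 12] -/
theorem ord_jInv_eq (h : IsABCTriple a b c) (hI : ∀ p ∈ Il, p.Prime) (hnd : Il.Nodup)
    (hD : (a * b * c) ^ 2 = (Il.map fun p => p ^ e p).prod) (v : HeightOneSpectrum (𝓞 ℚ)) :
    ord ℚ v (jInv ((a : ℚ) / c)) =
      ((256 * (c * b + a * a) ^ 3).factorization (natGenerator v) : ℤ) -
        ((if natGenerator v ∈ Il.toFinset then e (natGenerator v) else 0 : ℕ) : ℤ) :=
  ord_jInv_ratPoint (fun p hp => hI p (List.mem_toFinset.mp hp)) (prod_toFinset_eq hnd hD) (jInv_ratPoint_triple h)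
    (numerator_ne_zero h) v

/-- At a place over a prime NOT in the list: `ord_v j(a/c) ≥ 0`. [cite: MochizukiGenEll2010, Def. 3.3 p. 12] -/
theorem ord_jInv_nonneg_of_not_mem (h : IsABCTriple a b c) (hI : ∀ p ∈ Il, p.Prime) (hnd : Il.Nodup)
    (hD : (a * b * c) ^ 2 = (Il.map fun p => p ^ e p).prod) (v : HeightOneSpectrum (𝓞 ℚ)) (hv : natGenerator v ∉ Il) :
    0 ≤ ord ℚ v (jInv ((a : ℚ) / c)) :=
  ord_jInv_ratPoint_nonneg_of_not_mem (fun p hp => hI p (List.mem_toFinset.mp hp)) (prod_toFinset_eq hnd hD)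
    (jInv_ratPoint_triple h) (numerator_ne_zero h) v (fun hm => hv (List.mem_toFinset.mp hm))

/-- **At the place over an ODD prime `p ∈ Il`: `ord_v j(a/c) = −e_p`** (the numerator is prime to `p`: by the triple bound
`2·v_p(abc) ≤ −ord_v j` of `Cor22.neg_ord_jInv_ratPoint_triple` and `e_p = 2·v_p(abc)`). [cite: Mochizuki2012, IUTchIV Cor. 2.2 proof p. 44] -/
theorem ord_jInv_of_mem_odd (h : IsABCTriple a b c) (hI : ∀ p ∈ Il, p.Prime) (hnd : Il.Nodup) (he : ∀ p ∈ Il, e p ≠ 0)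
    (hD : (a * b * c) ^ 2 = (Il.map fun p => p ^ e p).prod) (v : HeightOneSpectrum (𝓞 ℚ))
    (hv : natGenerator v ∈ Il) (hv2 : natGenerator v ≠ 2) :
    ord ℚ v (jInv ((a : ℚ) / c)) = -(e (natGenerator v) : ℤ) := by
  have hε := e_eq_two_mul_factorization hI hnd hD hv
  have hfpos : 0 < (a * b * c).factorization (natGenerator v) := by
    have := he _ hv; omega
  have hdvd : natGenerator v ∣ a * b * c := Nat.dvd_of_factorization_pos (Nat.pos_iff_ne_zero.mp hfpos |> fun h0 => by
    intro h00; exact h0 (by rw [h00]))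
  have hle := neg_ord_jInv_ratPoint_triple h v hv2 hdvd
  have heq := ord_jInv_eq h hI hnd hD v
  rw [if_pos (List.mem_toFinset.mpr hv)] at heq
  have hN0 : 0 ≤ ((256 * (c * b + a * a) ^ 3).factorization (natGenerator v) : ℤ) := by positivity
  push_cast [hε] at heq hle ⊢
  omega

/-- **At the place over `2`: `ord_v j(a/c) = 8 − e_2`** (`e_2 := 0` off the list; `cb + a²` is odd). [folklore] -/
theorem ord_jInv_two (h : IsABCTriple a b c) (hI : ∀ p ∈ Il, p.Prime) (hnd : Il.Nodup)
    (hD : (a * b * c) ^ 2 = (Il.map fun p => p ^ e p).prod) (v : HeightOneSpectrum (𝓞 ℚ)) (hv : natGenerator v = 2) :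
    ord ℚ v (jInv ((a : ℚ) / c)) = 8 - ((if 2 ∈ Il then e 2 else 0 : ℕ) : ℤ) := by
  rw [ord_jInv_eq h hI hnd hD v, hv, factorization_numerator_two h]
  simp only [List.mem_toFinset]
  push_cast
  rfl

/-! ## §3 (P2), (P5), `AdmitsCore` at `ratPoint (a/c)` from decidable data -/

/-- **(P2) at `(ratPoint (a/c), l)` from the list dictionary**: if `l ∤ e_p` for every odd `p ∈ Il` and (`2 ∈ Il`, `e_2 > 8` ⇒
`l ∤ e_2 − 8`), then `l` divides no negative `ord_v j(a/c)`. [cite: Mochizuki2012, IUTchIV Cor. 2.2 (ii) proof (P2) p. 45]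
[claim: Mochizuki2012, status: disputed] -/
theorem condP2_triple (h : IsABCTriple a b c) (hI : ∀ p ∈ Il, p.Prime) (hnd : Il.Nodup) (he : ∀ p ∈ Il, e p ≠ 0)
    (hD : (a * b * c) ^ 2 = (Il.map fun p => p ^ e p).prod) {l : ℕ}
    (hl2 : ∀ p ∈ Il, p ≠ 2 → ¬ l ∣ e p) (hl8 : 2 ∈ Il → 8 < e 2 → ¬ l ∣ (e 2 - 8)) :
    CondP2 (ratPoint ((a : ℚ) / c)) l := by
  have key : ∀ v : HeightOneSpectrum (𝓞 ℚ), ord ℚ v (jInv ((a : ℚ) / c)) < 0 → ¬ ((l : ℤ) ∣ ord ℚ v (jInv ((a : ℚ) / c))) := by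
    intro v hneg
    by_cases hv : natGenerator v ∈ Il
    · by_cases hv2 : natGenerator v = 2
      · rw [ord_jInv_two h hI hnd hD v hv2] at hneg ⊢
        rw [hv2] at hv
        rw [if_pos hv] at hneg ⊢
        have h8 : 8 < e 2 := by
          by_contra hle
          have hle' : e 2 ≤ 8 := Nat.le_of_not_lt hle
          have : (0 : ℤ) ≤ 8 - ((e 2 : ℕ) : ℤ) := by omega
          exact absurd hneg (not_lt.mpr this)
        intro hdvd
        apply hl8 hv h8
        have hcast : ((8 : ℤ) - ((e 2 : ℕ) : ℤ)) = -(((e 2 - 8 : ℕ) : ℤ)) := by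
          rw [Nat.cast_sub h8.le]; push_cast; ring
        rw [hcast, dvd_neg] at hdvd
        exact_mod_cast hdvd
      · rw [ord_jInv_of_mem_odd h hI hnd he hD v hv hv2, dvd_neg]
        intro hdvd
        exact hl2 _ hv hv2 (by exact_mod_cast hdvd)
    · exact absurd hneg (not_lt.mpr (ord_jInv_nonneg_of_not_mem h hI hnd hD v hv))
  exact key

/-- **(P5) at `(ratPoint (a/c), l)`**: an odd prime `p₀ ∈ Il` with `p₀ ≠ l` gives a place with `ord j(a/c) = −e_{p₀} < 0` dividing
neither `2` nor `l`. [cite: Mochizuki2012, IUTchIV Cor. 2.2 (ii) proof (P5) p. 46] [claim: Mochizuki2012, status: disputed] -/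
theorem condP5_triple (h : IsABCTriple a b c) (hI : ∀ p ∈ Il, p.Prime) (hnd : Il.Nodup) (he : ∀ p ∈ Il, e p ≠ 0)
    (hD : (a * b * c) ^ 2 = (Il.map fun p => p ^ e p).prod) {l p₀ : ℕ} (hl : l.Prime) (hp₀ : p₀ ∈ Il)
    (h2 : p₀ ≠ 2) (hpl : p₀ ≠ l) : CondP5 (ratPoint ((a : ℚ) / c)) l := by
  have hpp : p₀.Prime := hI p₀ hp₀
  have key : ∃ v : HeightOneSpectrum (𝓞 ℚ), ord ℚ v (jInv ((a : ℚ) / c)) < 0 ∧ ((2 : ℕ) : 𝓞 ℚ) ∉ v.asIdeal ∧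
      ((l : ℕ) : 𝓞 ℚ) ∉ v.asIdeal := by
    set v : HeightOneSpectrum (𝓞 ℚ) := (primesEquiv (R := 𝓞 ℚ)).symm ⟨p₀, hpp⟩ with hvdef
    have hgen : natGenerator v = p₀ := FreyRef.natGenerator_primesEquiv_symm hpp
    refine ⟨v, ?_, ?_, ?_⟩
    · rw [ord_jInv_of_mem_odd h hI hnd he hD v (by rw [hgen]; exact hp₀) (by rw [hgen]; exact h2), hgen]
      have := he p₀ hp₀
      omega
    · rw [natCast_mem_asIdeal_iff, hgen]
      intro hd
      exact h2 ((Nat.prime_dvd_prime_iff_eq hpp Nat.prime_two).1 hd)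
    · rw [natCast_mem_asIdeal_iff, hgen]
      intro hd
      exact hpl ((Nat.prime_dvd_prime_iff_eq hpp hl).1 hd)
  exact key

end Dict

/-- **`AdmitsCore` at `ratPoint (a/c)`** from the rational check `2⁸(cb+a²)³/(abc)² ∉ {488095744/125, 1556068/81, 1728, 0}`
(`decide +kernel` at a datum). [cite: Mochizuki2012, IUTchIV Cor. 2.2 (ii) proof p. 43] [claim: Mochizuki2012, status: disputed] -/
theorem admitsCore_triple (h : IsABCTriple a b c)
    (hne : ∀ r ∈ coreExceptionalJ, ((256 * (c * b + a * a) ^ 3 : ℕ) : ℚ) / (((a * b * c) ^ 2 : ℕ) : ℚ) ≠ r) :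
    AdmitsCore (ratPoint ((a : ℚ) / c)) := by
  intro r hr
  change jInv ((a : ℚ) / c) ≠ r
  rw [jInv_ratPoint_triple h]
  exact hne r hr

/-! ## §4 INHABITED DATUM TYPES: `∀ l ∈ L, Nonempty (ThetaVolumeDatumAt (ratPoint (a/c)) l)` -/

/-- **INHABITED datum types at the Frey–Legendre point of an abc triple, LIST FORM.** For an abc triple `a + b = c` with
`(abc)² = ∏_{p ∈ Il} p^{e_p}` (`Il` a duplicate-free list of primes, `e_p ≥ 1`), `AdmitsCore` (rational check), a list `L` whose members
`l` are primes `≥ 5` with `l ∤ e_p` (odd `p ∈ Il`), `2 ∈ Il → e_2 > 8 → l ∤ e_2 − 8`, and some odd `p₀ ∈ Il` different from `l`, and (P6)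
at every `l ∈ L` (part 1 of the row), the datum type `Cor22.ThetaVolumeDatumAt (ratPoint (a/c)) l` is INHABITED for every `l ∈ L` —
the route's `ThetaPartII.stub_thetaData` fed with `UP` (W-ref-3), (P2)/(P5) (§3) and (P6). The two list hypotheses are single
`decide +kernel` goals at a datum. [cite: Mochizuki2012, IUTchIV Cor. 2.2 (ii) proof (P7) p. 46] [claim: Mochizuki2012, status: disputed] -/
theorem nonempty_thetaVolumeDatumAt_triple_list (h : IsABCTriple a b c) {Il : List ℕ} {e : ℕ → ℕ}
    (hI : ∀ p ∈ Il, p.Prime) (hnd : Il.Nodup) (he : ∀ p ∈ Il, e p ≠ 0)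
    (hD : (a * b * c) ^ 2 = (Il.map fun p => p ^ e p).prod)
    (hne : ∀ r ∈ coreExceptionalJ, ((256 * (c * b + a * a) ^ 3 : ℕ) : ℚ) / (((a * b * c) ^ 2 : ℕ) : ℚ) ≠ r)
    (L : List ℕ)
    (hside : ∀ l ∈ L, l.Prime ∧ 5 ≤ l ∧ (∀ p ∈ Il, p ≠ 2 → ¬ l ∣ e p) ∧ (2 ∈ Il → 8 < e 2 → ¬ l ∣ (e 2 - 8)) ∧
      (∃ p₀ ∈ Il, p₀ ≠ 2 ∧ p₀ ≠ l))
    (h6 : ∀ l ∈ L, CondP6 (ratPoint ((a : ℚ) / c)) l) :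
    ∀ l ∈ L, Nonempty (ThetaVolumeDatumAt (ratPoint ((a : ℚ) / c)) l) := by
  intro l hl
  obtain ⟨hlp, h5, hl2, hl8, p₀, hp₀, hp₀2, hp₀l⟩ := hside l hl
  exact ThetaPartII.stub_thetaData (ratPoint ((a : ℚ) / c)) (FreyRef.ratPoint_triple_mem_UP h) l hlp h5 (admitsCore_triple h hne)
    (condP2_triple h hI hnd he hD hl2 hl8) (condP5_triple h hI hnd he hD hlp hp₀ hp₀2 hp₀l) (h6 l hl)

end FreyAdm

end Summit.ABC.IUTFork.Conditional

end
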